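import Mathlib.Analysis.Complex.Basic
import HarnessLib

/-!
# Finite-dimensional algebra for moment-method certificates

Pure algebra over `Finset.range` sums used by the soundness proof of the certificate of
`Literature/NumberTheory/LFunctions/WeilPositivityCertificate.lean` (Yoshida's Theorem 1, Weil
positivity on `C((log 2)/2)`, by a kernel-checked finite computation): change of variables in a
Hermitian form (`quad_transform`), retraction `D (C v) = v` from `D C = I` (`lin_retract`), the
real part of a Hermitian form with real matrix as two real quadratic forms (`re_herm_eq`),
positivity from a certificate `S = R + UᵀU` with `R` diagonally dominant
(`quad_nonneg_of_dominant`, `quad_gram_nonneg`, `quad_nonneg_of_cert`, `re_herm_nonneg`), parity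
splitting of sums over `range (2m)` and the rounding error of a quadratic form
(`quad_rounding_le`). Matrices and vectors are plain functions `ℕ → ℕ → R`, `ℕ → R` restricted to
`range m`, the format in which the certificate checker tabulates its data.

Everything here is proved; there are no definitions and no named facts.
-/

noncomputable section

open Complex Finset
open scoped Real ComplexConjugate BigOperators

namespace Literature.NumberTheory.LFunctions

namespace WeilAlg

/-- Interchange `Σ_i Σ_i' Σ_j Σ_j' = Σ_j Σ_j' Σ_i Σ_i'`. [folklore] -/
theorem sum_four_comm {β : Type*} [AddCommMonoid β] (s t : Finset ℕ) (F : ℕ → ℕ → ℕ → ℕ → β) :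
    ∑ i ∈ s, ∑ i' ∈ s, ∑ j ∈ t, ∑ j' ∈ t, F i i' j j' =
      ∑ j ∈ t, ∑ j' ∈ t, ∑ i ∈ s, ∑ i' ∈ s, F i i' j j' := by
  calc ∑ i ∈ s, ∑ i' ∈ s, ∑ j ∈ t, ∑ j' ∈ t, F i i' j j'
      = ∑ i ∈ s, ∑ j ∈ t, ∑ i' ∈ s, ∑ j' ∈ t, F i i' j j' :=
        Finset.sum_congr rfl fun i _ ↦ Finset.sum_comm
    _ = ∑ j ∈ t, ∑ i ∈ s, ∑ i' ∈ s, ∑ j' ∈ t, F i i' j j' := Finset.sum_comm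
    _ = ∑ j ∈ t, ∑ i ∈ s, ∑ j' ∈ t, ∑ i' ∈ s, F i i' j j' :=
        Finset.sum_congr rfl fun j _ ↦ Finset.sum_congr rfl fun i _ ↦ Finset.sum_comm
    _ = ∑ j ∈ t, ∑ j' ∈ t, ∑ i ∈ s, ∑ i' ∈ s, F i i' j j' :=
        Finset.sum_congr rfl fun j _ ↦ Finset.sum_comm

/-- **Change of variables in a Hermitian form.** For `v_i = Σ_{j<m} E_{ij} w_j` (`E` real),
`Σ_{i,i'<m'} A_{ii'} conj(v_i) v_{i'} = Σ_{j,j'<m} (Σ_{i,i'<m'} E_{ij} A_{ii'} E_{i'j'}) conj(w_j) w_{j'}`. [folklore] -/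
theorem quad_transform (m m' : ℕ) (A : ℕ → ℕ → ℂ) (E : ℕ → ℕ → ℝ) (w : ℕ → ℂ) :
    ∑ i ∈ range m', ∑ i' ∈ range m', A i i' *
        (conj (∑ j ∈ range m, (E i j : ℂ) * w j) * ∑ j' ∈ range m, (E i' j' : ℂ) * w j') =
      ∑ j ∈ range m, ∑ j' ∈ range m,
        (∑ i ∈ range m', ∑ i' ∈ range m', (E i j : ℂ) * A i i' * E i' j') * (conj (w j) * w j') := by
  have lhs : ∀ i i', A i i' *
      (conj (∑ j ∈ range m, (E i j : ℂ) * w j) * ∑ j' ∈ range m, (E i' j' : ℂ) * w j') =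
      ∑ j ∈ range m, ∑ j' ∈ range m, (E i j : ℂ) * A i i' * E i' j' * (conj (w j) * w j') := by
    intro i i'
    rw [map_sum, Finset.sum_mul_sum, Finset.mul_sum]
    refine Finset.sum_congr rfl fun j _ ↦ ?_
    rw [Finset.mul_sum]
    refine Finset.sum_congr rfl fun j' _ ↦ ?_
    rw [map_mul, Complex.conj_ofReal]
    ring
  simp_rw [lhs]
  rw [sum_four_comm]
  refine Finset.sum_congr rfl fun j _ ↦ Finset.sum_congr rfl fun j' _ ↦ ?_
  rw [Finset.sum_mul]
  refine Finset.sum_congr rfl fun i _ ↦ ?_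
  rw [Finset.sum_mul]

/-- Real version: for `v_i = Σ_j E_{ij} x_j`,
`Σ_{i,i'} A_{ii'} v_i v_{i'} = Σ_{j,j'} (Σ_{i,i'} E_{ij} A_{ii'} E_{i'j'}) x_j x_{j'}`. [folklore] -/
theorem quad_transform_real (m m' : ℕ) (A : ℕ → ℕ → ℝ) (E : ℕ → ℕ → ℝ) (x : ℕ → ℝ) :
    ∑ i ∈ range m', ∑ i' ∈ range m', A i i' *
        ((∑ j ∈ range m, E i j * x j) * ∑ j' ∈ range m, E i' j' * x j') =
      ∑ j ∈ range m, ∑ j' ∈ range m,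
        (∑ i ∈ range m', ∑ i' ∈ range m', E i j * A i i' * E i' j') * (x j * x j') := by
  have lhs : ∀ i i', A i i' * ((∑ j ∈ range m, E i j * x j) * ∑ j' ∈ range m, E i' j' * x j') =
      ∑ j ∈ range m, ∑ j' ∈ range m, E i j * A i i' * E i' j' * (x j * x j') := by
    intro i i'
    rw [Finset.sum_mul_sum, Finset.mul_sum]
    refine Finset.sum_congr rfl fun j _ ↦ ?_
    rw [Finset.mul_sum]
    refine Finset.sum_congr rfl fun j' _ ↦ ?_
    ring
  simp_rw [lhs]
  rw [sum_four_comm]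
  refine Finset.sum_congr rfl fun j _ ↦ Finset.sum_congr rfl fun j' _ ↦ ?_
  rw [Finset.sum_mul]
  refine Finset.sum_congr rfl fun i _ ↦ ?_
  rw [Finset.sum_mul]

/-- **Retraction.** If `Σ_j D_{ij} C_{ji'} = δ_{ii'}` on `range m` then `D (C v) = v`. [folklore] -/
theorem lin_retract (m : ℕ) (D C : ℕ → ℕ → ℝ) (v : ℕ → ℂ)
    (hDC : ∀ i ∈ range m, ∀ i' ∈ range m,
      ∑ j ∈ range m, (D i j : ℂ) * C j i' = if i = i' then 1 else 0)
    {i : ℕ} (hi : i ∈ range m) :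
    ∑ j ∈ range m, (D i j : ℂ) * ∑ i' ∈ range m, (C j i' : ℂ) * v i' = v i := by
  calc ∑ j ∈ range m, (D i j : ℂ) * ∑ i' ∈ range m, (C j i' : ℂ) * v i'
      = ∑ i' ∈ range m, (∑ j ∈ range m, (D i j : ℂ) * C j i') * v i' := by
        simp_rw [Finset.mul_sum, Finset.sum_mul]
        rw [Finset.sum_comm]
        refine Finset.sum_congr rfl fun i' _ ↦ Finset.sum_congr rfl fun j _ ↦ ?_
        ring
    _ = ∑ i' ∈ range m, (if i = i' then (1 : ℂ) else 0) * v i' := by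
        refine Finset.sum_congr rfl fun i' hi' ↦ ?_
        rw [hDC i hi i' hi']
    _ = v i := by
        simp only [ite_mul, one_mul, zero_mul, Finset.sum_ite_eq, hi, ↓reduceIte]

/-- The real part of a Hermitian form with real matrix splits into the real quadratic forms of the
real and imaginary parts. [folklore] -/
theorem re_herm_eq (m : ℕ) (S : ℕ → ℕ → ℝ) (y : ℕ → ℂ) :
    (∑ j ∈ range m, ∑ j' ∈ range m, (S j j' : ℂ) * (conj (y j) * y j')).re =
      ∑ j ∈ range m, ∑ j' ∈ range m, S j j' * ((y j).re * (y j').re) +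
        ∑ j ∈ range m, ∑ j' ∈ range m, S j j' * ((y j).im * (y j').im) := by
  rw [← Finset.sum_add_distrib, Complex.re_sum]
  refine Finset.sum_congr rfl fun j _ ↦ ?_
  rw [← Finset.sum_add_distrib, Complex.re_sum]
  refine Finset.sum_congr rfl fun j' _ ↦ ?_
  simp only [Complex.mul_re, Complex.ofReal_re, Complex.ofReal_im, Complex.conj_re,
    Complex.conj_im, Complex.mul_im]
  ring

/-- `xᵀ (Uᵀ U) x = Σ_k (Σ_j U_{kj} x_j)² ≥ 0`. [folklore] -/
theorem quad_gram_nonneg (m : ℕ) (U : ℕ → ℕ → ℝ) (x : ℕ → ℝ) :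
    0 ≤ ∑ j ∈ range m, ∑ j' ∈ range m, (∑ k ∈ range m, U k j * U k j') * (x j * x j') := by
  have e : ∑ j ∈ range m, ∑ j' ∈ range m, (∑ k ∈ range m, U k j * U k j') * (x j * x j') =
      ∑ k ∈ range m, (∑ j ∈ range m, U k j * x j) ^ 2 := by
    calc ∑ j ∈ range m, ∑ j' ∈ range m, (∑ k ∈ range m, U k j * U k j') * (x j * x j')
        = ∑ j ∈ range m, ∑ j' ∈ range m, ∑ k ∈ range m, U k j * U k j' * (x j * x j') := by
          simp_rw [Finset.sum_mul]
      _ = ∑ j ∈ range m, ∑ k ∈ range m, ∑ j' ∈ range m, U k j * U k j' * (x j * x j') :=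
          Finset.sum_congr rfl fun j _ ↦ Finset.sum_comm
      _ = ∑ k ∈ range m, ∑ j ∈ range m, ∑ j' ∈ range m, U k j * U k j' * (x j * x j') :=
          Finset.sum_comm
      _ = ∑ k ∈ range m, (∑ j ∈ range m, U k j * x j) ^ 2 := by
          refine Finset.sum_congr rfl fun k _ ↦ ?_
          rw [sq, Finset.sum_mul_sum]
          refine Finset.sum_congr rfl fun j _ ↦ Finset.sum_congr rfl fun j' _ ↦ ?_
          ring
  rw [e]
  exact Finset.sum_nonneg fun k _ ↦ sq_nonneg _

/-- **Diagonal dominance implies positive semidefiniteness** (no symmetry assumed):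
if `Σ_{j≠i} (|R_{ij}| + |R_{ji}|)/2 ≤ R_{ii}` for all `i < m` then `xᵀ R x ≥ 0`. [folklore] -/
theorem quad_nonneg_of_dominant (m : ℕ) (R : ℕ → ℕ → ℝ)
    (hdom : ∀ i ∈ range m,
      ∑ j ∈ range m, (if j = i then 0 else (|R i j| + |R j i|) / 2) ≤ R i i)
    (x : ℕ → ℝ) :
    0 ≤ ∑ i ∈ range m, ∑ j ∈ range m, R i j * (x i * x j) := by
  -- termwise lower bound
  have h1 : ∀ i j, (if j = i then R i i * x i ^ 2 else -(|R i j| * (x i ^ 2 + x j ^ 2) / 2)) ≤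
      R i j * (x i * x j) := by
    intro i j
    split_ifs with hij
    · subst hij; rw [sq]
    · have h := neg_abs_le (R i j * (x i * x j))
      rw [abs_mul, abs_mul] at h
      nlinarith [two_mul_le_add_sq (|x i|) (|x j|), abs_nonneg (R i j), sq_abs (x i), sq_abs (x j),
        abs_nonneg (x i), abs_nonneg (x j)]
  have h2 : ∑ i ∈ range m, ∑ j ∈ range m,
      (if j = i then R i i * x i ^ 2 else -(|R i j| * (x i ^ 2 + x j ^ 2) / 2)) ≤
      ∑ i ∈ range m, ∑ j ∈ range m, R i j * (x i * x j) :=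
    Finset.sum_le_sum fun i _ ↦ Finset.sum_le_sum fun j _ ↦ h1 i j
  refine le_trans ?_ h2
  -- evaluate the minorant: Σ_i x_i² (R_ii − Σ_{j≠i} (|R_ij| + |R_ji|)/2)
  have h3 : ∑ i ∈ range m, ∑ j ∈ range m,
      (if j = i then R i i * x i ^ 2 else -(|R i j| * (x i ^ 2 + x j ^ 2) / 2)) =
      ∑ i ∈ range m, (R i i * x i ^ 2 -
        ∑ j ∈ range m, (if j = i then 0 else |R i j| * x i ^ 2 / 2)) -
      ∑ i ∈ range m, ∑ j ∈ range m, (if j = i then 0 else |R i j| * x j ^ 2 / 2) := by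
    rw [← Finset.sum_sub_distrib]
    refine Finset.sum_congr rfl fun i hi ↦ ?_
    have e1 : ∀ j, (if j = i then R i i * x i ^ 2 else -(|R i j| * (x i ^ 2 + x j ^ 2) / 2)) =
        (if j = i then R i i * x i ^ 2 else 0) - (if j = i then 0 else |R i j| * x i ^ 2 / 2) -
          (if j = i then 0 else |R i j| * x j ^ 2 / 2) := fun j ↦ by
      split_ifs <;> ring
    simp_rw [e1]
    rw [Finset.sum_sub_distrib, Finset.sum_sub_distrib, Finset.sum_ite_eq', if_pos hi]
  -- swap the last double sum
  have h4 : ∑ i ∈ range m, ∑ j ∈ range m, (if j = i then 0 else |R i j| * x j ^ 2 / 2) =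
      ∑ i ∈ range m, ∑ j ∈ range m, (if j = i then 0 else |R j i| * x i ^ 2 / 2) := by
    rw [Finset.sum_comm]
    refine Finset.sum_congr rfl fun i _ ↦ Finset.sum_congr rfl fun j _ ↦ ?_
    by_cases h : i = j
    · subst h; simp
    · rw [if_neg h, if_neg (Ne.symm h)]
  rw [h3, h4, ← Finset.sum_sub_distrib]
  refine Finset.sum_nonneg fun i hi ↦ ?_
  have hd := hdom i hi
  have e : R i i * x i ^ 2 - ∑ j ∈ range m, (if j = i then 0 else |R i j| * x i ^ 2 / 2) -
      ∑ j ∈ range m, (if j = i then 0 else |R j i| * x i ^ 2 / 2) =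
      x i ^ 2 * (R i i - ∑ j ∈ range m, (if j = i then 0 else (|R i j| + |R j i|) / 2)) := by
    rw [mul_sub, Finset.mul_sum, sub_sub, ← Finset.sum_add_distrib]
    congr 1
    · ring
    · refine Finset.sum_congr rfl fun j _ ↦ ?_
      split_ifs <;> ring
  rw [e]
  exact mul_nonneg (sq_nonneg _) (sub_nonneg.2 hd)

/-- **PSD from a certificate `S = R + UᵀU` with `R` dominant.** [folklore] -/
theorem quad_nonneg_of_cert (m : ℕ) (S U : ℕ → ℕ → ℝ)
    (hdom : ∀ i ∈ range m,
      ∑ j ∈ range m, (if j = i then 0 else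
        (|S i j - ∑ k ∈ range m, U k i * U k j| + |S j i - ∑ k ∈ range m, U k j * U k i|) / 2) ≤
        S i i - ∑ k ∈ range m, U k i * U k i)
    (x : ℕ → ℝ) :
    0 ≤ ∑ i ∈ range m, ∑ j ∈ range m, S i j * (x i * x j) := by
  have h1 := quad_nonneg_of_dominant m (fun i j ↦ S i j - ∑ k ∈ range m, U k i * U k j) hdom x
  have h2 := quad_gram_nonneg m U x
  have e : ∑ i ∈ range m, ∑ j ∈ range m, S i j * (x i * x j) =
      ∑ i ∈ range m, ∑ j ∈ range m, (S i j - ∑ k ∈ range m, U k i * U k j) * (x i * x j) +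
      ∑ i ∈ range m, ∑ j ∈ range m, (∑ k ∈ range m, U k i * U k j) * (x i * x j) := by
    rw [← Finset.sum_add_distrib]
    refine Finset.sum_congr rfl fun i _ ↦ ?_
    rw [← Finset.sum_add_distrib]
    refine Finset.sum_congr rfl fun j _ ↦ ?_
    ring
  rw [e]
  exact add_nonneg h1 h2

/-- Real part of a Hermitian form with a real PSD matrix is non-negative. [folklore] -/
theorem re_herm_nonneg (m : ℕ) (S : ℕ → ℕ → ℝ)
    (hS : ∀ x : ℕ → ℝ, 0 ≤ ∑ i ∈ range m, ∑ j ∈ range m, S i j * (x i * x j)) (y : ℕ → ℂ) :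
    0 ≤ (∑ j ∈ range m, ∑ j' ∈ range m, (S j j' : ℂ) * (conj (y j) * y j')).re := by
  rw [re_herm_eq]
  exact add_nonneg (hS _) (hS _)

/-- **Parity split of a sum over `range (2m)`.** [folklore] -/
theorem sum_range_two_mul {β : Type*} [AddCommMonoid β] (m : ℕ) (F : ℕ → β) :
    ∑ k ∈ range (2 * m), F k = ∑ i ∈ range m, F (2 * i) + ∑ i ∈ range m, F (2 * i + 1) := by
  induction m with
  | zero => simp
  | succ m ih =>
    rw [show 2 * (m + 1) = 2 * m + 1 + 1 by ring, Finset.sum_range_succ, Finset.sum_range_succ, ih,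
      Finset.sum_range_succ, Finset.sum_range_succ]
    abel

/-- Parity split of a double sum whose cross-parity terms vanish. [folklore] -/
theorem sum_sum_range_two_mul {β : Type*} [AddCommMonoid β] (m : ℕ) (F : ℕ → ℕ → β)
    (hF : ∀ k l, k % 2 ≠ l % 2 → F k l = 0) :
    ∑ k ∈ range (2 * m), ∑ l ∈ range (2 * m), F k l =
      ∑ i ∈ range m, ∑ j ∈ range m, F (2 * i) (2 * j) +
        ∑ i ∈ range m, ∑ j ∈ range m, F (2 * i + 1) (2 * j + 1) := by
  rw [sum_range_two_mul]
  congr 1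
  · refine Finset.sum_congr rfl fun i _ ↦ ?_
    rw [sum_range_two_mul]
    have : ∑ j ∈ range m, F (2 * i) (2 * j + 1) = 0 :=
      Finset.sum_eq_zero fun j _ ↦ hF _ _ (by omega)
    rw [this, add_zero]
  · refine Finset.sum_congr rfl fun i _ ↦ ?_
    rw [sum_range_two_mul]
    have : ∑ j ∈ range m, F (2 * i + 1) (2 * j) = 0 :=
      Finset.sum_eq_zero fun j _ ↦ hF _ _ (by omega)
    rw [this, zero_add]

/-- **Rounding error of a quadratic form.** If `|A_{kl} − B_{kl}| ≤ δ` and `‖M_k‖ ≤ L` then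
`Σ B_{kl} Re(conj M_k M_l) ≥ Σ A_{kl} Re(conj M_k M_l) − δ m² L²`... stated as
`Σ A z − Σ B z ≤ δ m² L²`. [folklore] -/
theorem quad_rounding_le (m : ℕ) (A B : ℕ → ℕ → ℝ) (δ L : ℝ) (hδ : ∀ k l, |A k l - B k l| ≤ δ)
    (M : ℕ → ℂ) (hM : ∀ k, ‖M k‖ ≤ L) :
    ∑ k ∈ range m, ∑ l ∈ range m, A k l * (conj (M k) * M l).re -
        ∑ k ∈ range m, ∑ l ∈ range m, B k l * (conj (M k) * M l).re ≤
      δ * (m : ℝ) ^ 2 * L ^ 2 := by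
  have hL : 0 ≤ L := (norm_nonneg _).trans (hM 0)
  have hδ0 : 0 ≤ δ := (abs_nonneg _).trans (hδ 0 0)
  rw [← Finset.sum_sub_distrib]
  simp_rw [← Finset.sum_sub_distrib, ← sub_mul]
  calc ∑ k ∈ range m, ∑ l ∈ range m, (A k l - B k l) * (conj (M k) * M l).re
      ≤ ∑ k ∈ range m, ∑ l ∈ range m, δ * L ^ 2 := by
        refine Finset.sum_le_sum fun k _ ↦ Finset.sum_le_sum fun l _ ↦ ?_
        have h1 : |(conj (M k) * M l).re| ≤ L * L := by
          refine (Complex.abs_re_le_norm _).trans ?_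
          rw [norm_mul, Complex.norm_conj]
          exact mul_le_mul (hM k) (hM l) (norm_nonneg _) hL
        have h2 := hδ k l
        calc (A k l - B k l) * (conj (M k) * M l).re
            ≤ |(A k l - B k l) * (conj (M k) * M l).re| := le_abs_self _
          _ = |A k l - B k l| * |(conj (M k) * M l).re| := abs_mul _ _
          _ ≤ δ * (L * L) := mul_le_mul h2 h1 (abs_nonneg _) hδ0
          _ = δ * L ^ 2 := by ring
    _ = δ * (m : ℝ) ^ 2 * L ^ 2 := by
        simp only [Finset.sum_const, Finset.card_range, nsmul_eq_mul]
        ring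

end WeilAlg

end Literature.NumberTheory.LFunctions
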